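import Summits.BirchSwinnertonDyer.BirchSwinnertonDyer.Theorems.Rank2ObservatoryTwoDescClRSNR3Rows0001
import Summits.BirchSwinnertonDyer.BirchSwinnertonDyer.Theorems.Rank2ObservatoryRank3KernelCensus
import Summits.BirchSwinnertonDyer.BirchSwinnertonDyer.Theorems.Rank2ObservatoryRank3TableDecEq
import HarnessLib

/-!
# BirchSwinnertonDyer — rank ≥ 2 observatory: KERNEL-2DESC rank-3 CENSUS AGGREGATE, part 37 (1 rows, direct form)

HONEST FRAMING: per-curve certified theorems and census instruments; no claim on BSD in rank ≥ 2.

Part 37 of the one-stop rank-3 census aggregate (`Rank2ObservatoryRank3TwoDescCensus` / `…CensusFinal` and successors; split for the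
400-line file limit): `Part37.rows` (DATA) = 1 rows of the census table `rank3Table` (odd torsion, conductors
`450754 … 450754`), copied verbatim from the census chunks `Rank2ObservatoryRank3Rows<NN>`, grouped by providing module
(oldest first; conductor order within a module), each of whose hypothesis-free kernel theorem `C<label>.mordellWeilRank_eq_three :
rank_ℤ E(ℚ) = 3` is in the tree
(0 per-curve files `Rank2Observatory<label>TwoDesc[Cl]RankThree`, 1 row shards `Rank2ObservatoryTwoDesc…R3[R]Rows<k>`; upper bound:
the row's general 2-descent over its cubic 2-division field — Cassels' `x − θ` map, fewer than `2⁴` admissible classes survive the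
local sieve, counted by `decide` in the kernel; lower bound: the kernel height-pairing / reduction certificate
`Rank2ObservatoryRank3KernelCerts*.C<label>.three_le_rank`).
DIRECT FORM (cert-2 gen 21): the two facts per row are proved HERE from the row theorems — membership of the row in its census
chunk by a kernel `decide` (glue `mem_rank3Table_of_mem_rowsNN`, `Rank2ObservatoryRank3KernelCensus`) and `rank_ℤ = 3` by
`C<label>.mordellWeilRank_eq_three` along the definitional identity row model = integral model (`curve_eq_map`), one `row_intro`
link per row — instead of through intermediate 15-row join files `Rank2ObservatoryRank3TwoDescRows<KKK>`.  The interface is that of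
parts 1–10 (`rows`, `rows_length`, `mem_rank3Table`, `rank_eq_three : ∀ r ∈ rows, rank_ℤ(E_r(ℚ)) = 3`, `rank_eq_three_and_mem`,
all with NO hypothesis), so the census tops consume it unchanged (`List.forall_mem_append`).  Sorry-free; no new axioms.
References: J. W. S. Cassels, *Lectures on Elliptic Curves* (1991) §15; J. E. Cremona, *Algorithms for Modular Elliptic Curves*
(2nd ed. 1997) Tables, §3.5, §3.6.
-/

-- single-conjunct summit: `Summit.BirchSwinnertonDyer.BirchSwinnertonDyer.…` repeats the name by design
set_option linter.dupNamespace false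
-- deep literal lists / one nested term per row: raise the recursion budget for the whole file
set_option maxRecDepth 400000

namespace Summit.BirchSwinnertonDyer.BirchSwinnertonDyer.Rank2Observatory.TwoDescRank3Census.Part37

open Literature Literature.NumberTheory.EllipticCurves WeierstrassCurve

/-- Row model = integral model base-changed to `ℚ` (definitional). [folklore] -/
private theorem curve_eq_map (l : String) (a₁ a₂ a₃ a₄ a₆ : ℤ) (N : ℕ) (D s : ℤ) (P₁ P₂ P₃ : ℤ × ℤ × ℤ) :
    (⟨l, a₁, a₂, a₃, a₄, a₆, N, D, s, P₁, P₂, P₃⟩ : Rank3Row).curve =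
      (⟨a₁, a₂, a₃, a₄, a₆⟩ : WeierstrassCurve ℤ).map (Int.castRingHom ℚ) :=
  rfl

/-- One link of the row chain: head row `⟨l, a₁, …⟩` (table membership; `rank_ℤ = 3` stated for the INTEGRAL model
`⟨a₁, a₂, a₃, a₄, a₆⟩` base-changed to `ℚ`, which is the row model by `curve_eq_map` = `rfl`) + the tail. [folklore] -/
private theorem row_intro {l : String} {a₁ a₂ a₃ a₄ a₆ : ℤ} {N : ℕ} {D s : ℤ} {P₁ P₂ P₃ : ℤ × ℤ × ℤ} {t : List Rank3Row}
    (hm : (⟨l, a₁, a₂, a₃, a₄, a₆, N, D, s, P₁, P₂, P₃⟩ : Rank3Row) ∈ rank3Table)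
    (hr : ((⟨a₁, a₂, a₃, a₄, a₆⟩ : WeierstrassCurve ℤ).map (Int.castRingHom ℚ)).mordellWeilRank = 3)
    (ht : ∀ r' ∈ t, r' ∈ rank3Table ∧ r'.curve.mordellWeilRank = 3) :
    ∀ r' ∈ (⟨l, a₁, a₂, a₃, a₄, a₆, N, D, s, P₁, P₂, P₃⟩ : Rank3Row) :: t, r' ∈ rank3Table ∧ r'.curve.mordellWeilRank = 3 :=
  List.forall_mem_cons.2 ⟨⟨hm, (curve_eq_map l a₁ a₂ a₃ a₄ a₆ N D s P₁ P₂ P₃).symm ▸ hr⟩, ht⟩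

/-- A row is a member of its census chunk: read off position `n` (kernel `decide` on `l[n]? = some r`). [folklore] -/
private theorem memIdx {l : List Rank3Row} {r : Rank3Row} (n : ℕ) (h : l[n]? = some r) : r ∈ l :=
  List.mem_of_getElem? h

/-- End of the row chain. [folklore] -/
private theorem rows_nil : ∀ r' ∈ ([] : List Rank3Row), r' ∈ rank3Table ∧ r'.curve.mordellWeilRank = 3 := by
  simp

/-- DATA: the 1 census rows of this part (verbatim from the chunks `rank3Rows<NN>`; grouped by providing module). [cite: CremonaAlgorithms1997, Tables] -/
def rows : List Rank3Row :=
 [⟨"450754a1", 1, 1, 0, -277, 1565, 450754, -143, 128670, (22, 71, 1), (-19, 30, 1), (14, 19, 1)⟩]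

/-- `rows.length = 1`. -/
theorem rows_length : rows.length = 1 := by
  decide +kernel

/-- Both facts per row of this part — **row of `rank3Table`** (kernel `decide` in the row's chunk) **and `rank_ℤ E_r(ℚ) = 3`, NO
hypothesis** (`C<label>.mordellWeilRank_eq_three`, per row). [cite: CremonaAlgorithms1997, Tables] [cite: Cassels1991LecturesEllipticCurves, §15] -/
theorem rank_eq_three_and_mem : ∀ r ∈ rows, r ∈ rank3Table ∧ r.curve.mordellWeilRank = 3 :=
    row_intro (mem_rank3Table_of_mem_rows23 (memIdx 300 (by decide +kernel))) C450754a1.mordellWeilRank_eq_three <|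
    rows_nil

/-- **Every row of this part is a row of the census table `rank3Table`.** [cite: CremonaAlgorithms1997, Tables] -/
theorem mem_rank3Table : ∀ r ∈ rows, r ∈ rank3Table :=
  fun r hr => (rank_eq_three_and_mem r hr).1

/-- **`rank_ℤ E_r(ℚ) = 3` for every row of this part, NO hypothesis** (kernel 2-descent upper bound + kernel point
certificate, per row). [cite: Cassels1991LecturesEllipticCurves, §15] [cite: CremonaAlgorithms1997, §3.5] -/
theorem rank_eq_three : ∀ r ∈ rows, r.curve.mordellWeilRank = 3 :=
  fun r hr => (rank_eq_three_and_mem r hr).2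

end Summit.BirchSwinnertonDyer.BirchSwinnertonDyer.Rank2Observatory.TwoDescRank3Census.Part37
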